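import Summits.BirchSwinnertonDyer.BirchSwinnertonDyer.Theorems.ResidualThetaTransportAtTwoResidualSignedLambdaLowerCMAtTwoLayerPairingOfFunMackeyDual
import Summits.BirchSwinnertonDyer.BirchSwinnertonDyer.Theorems.ResidualThetaTransportAtTwoResidualSignedLambdaLowerCMAtTwoCosetFrameOdd
import Literature.NumberTheory.EllipticCurves.BSDShaProofs
import Mathlib.Algebra.Module.CharacterModule
import HarnessLib

/-!
# S4₀'s (α)-class FROM the S₀-frame's characters, and its readback: a character of `D_w = H¹(ℚ_{∞,w̃}, A_ρ)` read on the layer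
# `H¹(U_{n,w}, A_ρ[2^k]|)` through `j_{n,k}` IS a layer class under the local Tate pairing (local duality, N4), and a `Cosets κ w`-indexed
# family of characters IS one local class `t ∈ H¹(ℚ_w, Maps(Γ_ℚ ⧸ Γ_n, A_ρ[2^k]))` whose pairing against `loc_w(H¹(Ψ)(Sh a))` is the
# coset sum of layer pairings against the conjugates `loc_n(σ_c · a)` (Mackey, with the index datum of `…CosetFrameOdd`)

Route `ResidualThetaTransportAtTwo` (RTT), crux RSL_g `ResidualSignedLambdaLowerCMAtTwo` (stmt-BirchSwinnertonDyer-22608); seat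
`prover-bsd-wall-tp2-p2x` g19 (`--supports 22608 --as helper`, closes nothing). THEOREMS ONLY (no definition, no named fact, no instance,
no notation, no `sorry`). BSD is not proved by any of this; RSL_g is not proved here.

WHY (STUB-PLAN rev 22 S96: «the (α) ↔ (β) reading is owned by the S4₀ S₀-pin transfer»). The S4₀ text (LEAD rtt-p2 g18, 05:23:34Z) hands the
prover a character `χ : PAway = Π_{w ∈ S₀} Π_{c : Cosets κ w} CharacterModule (Dloc w)`; the assembled socket
`DeepHalfAssemblyAway.exists_iwasawaH1_prescribed_of_levelwise_orthogonal` (p697362) wants, per `(n, k, w)`, ONE local class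
`t n k w ∈ H¹(ℚ_w, Maps(Γ_ℚ ⧸ Γ_n, A_ρ[p^k]))` (currency (α)) and reads it only through the canonical local Tate pairing against
`loc_w(H¹(Ψ)(Sh b))`. This file builds `t` from `χ` and computes that pairing:

* §1 (pure algebra) **`exists_zmodHom_of_nsmul_eq_zero`** / `zmod_eq_of_val_smul_eq`: an additive `ψ : D →+ ℚ/ℤ` on an `N`-torsion group is
  `y ↦ (f y).val • N⁻¹` for a unique `f : D →+ ℤ/N` (the converse of `ReciprocityReceptacle` §Z).
* §2 (generic finite discrete `M`, non-degenerate `e : M × M → μ_N`, `N • M = 0`) **`existsUnique_layerClass_of_addCircleHom`**: every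
  `ψ : H¹(U_n, M|) →+ ℚ/ℤ` is `y ↦ (⟨b, y⟩_{n,N,v}).val • N⁻¹` for a UNIQUE layer class `b` (N4 `layerPairingH1Of_bijective`).
* §3 (`ρ`-instantiation, the pin's currency) **`existsUnique_dlev_of_character`**: for `χ : CharacterModule (Dloc S κ ρ w)` and `(m, k)`,
  `χ (jAway w m k y) = (⟨b, y⟩_{m,2^k,w}).val • 2^{-k}` for a unique `b ∈ Dlev w m k` — the value law of `AwayPins.hlocdS` read backwards.
* §4 **`exists_local_of_characters`**: for `χ : Cosets κ w → CharacterModule (Dloc w)`, `n ≥ nfl w`, `k`: layer classes `b c` as in §3 and ONE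
  local class `t` (currency (α)) with Mackey components `H¹(Φ_{c.out Γ_n}) t = Sh(b c)` (`exists_local_forall_component_eq` with the index datum
  `CosetFrame.bijective_cosets_out`), AND the readback in p697362's `hT` currency
  `⟨t, loc_w(H¹(Ψ)(Sh a))⟩_{canonical} = ∑ c, ⟨b c, loc_n(c.out · a)⟩_{n,2^k,w}` for every `a ∈ H¹(Γ_n, A_ρ[2^k])`
  (`localization_cohomologyMap_coindTateDualMor`, N4 §4, `cohomologyMap_resCoindFinHomR_localization_shapiroLift`).

References: [MilneADT2006] I Cor. 2.3, I §6 (proof of Prop. 6.9); [NeukirchSchmidtWingberg2008] I §5 (1.5.3)(iv), (1.5.6)–(1.5.7), I §6 (1.6.4)–(1.6.5);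
[Brown1982] III §5 (5.6)(b); [Kobayashi2003] (8.23); [PerrinRiou1994Invent] §3.6.1; [Kato2004Asterisque] §17.13.
-/

set_option autoImplicit false
-- the Theorems namespace of this sub repeats the summit name by design (D-0017 nested layout)
set_option linter.dupNamespace false

noncomputable section

open scoped Classical

namespace Summit.BirchSwinnertonDyer.BirchSwinnertonDyer.Theorems

namespace ThetaTransport.AwayCharacterReadback

open CategoryTheory Function Field NumberField IsDedekindDomain
  Literature.NumberTheory.EllipticCurves Literature.NumberTheory.EllipticCurves.CyclotomicLayer
  Literature.NumberTheory.EllipticCurves.GreenbergSelmer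
  Literature.NumberTheory.GaloisRepresentations Literature.NumberTheory.GaloisRepresentations.DiscreteGaloisModule
  Literature.NumberTheory.GaloisCohomology ZpExtension
  Summit.BirchSwinnertonDyer.BirchSwinnertonDyer.Theorems.OnePair
open ThetaTransport.LayerPairingNondegenerate ThetaTransport.LayerPairingMackeyDual

/-! ## §1 Pure algebra: `ℚ/ℤ`-valued additive maps on an `N`-torsion group factor through `ℤ/N`, `t ↦ t.val • N⁻¹` -/

section Algebra

variable {D : Type*} [AddCommGroup D] {N : ℕ} [NeZero N]

/-- `N⁻¹ ∈ ℚ/ℤ` has additive order `N`. [cite: Kato2004Asterisque, §17.13 (p. 279)] -/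
theorem addOrderOf_inv_natCast : addOrderOf ((((N : ℚ))⁻¹ : ℚ) : AddCircle (1 : ℚ)) = N := by
  have hpos : 0 < N := Nat.pos_of_ne_zero (NeZero.ne N)
  have h1 := AddCircle.addOrderOf_div_of_gcd_eq_one (p := (1 : ℚ)) (m := 1) hpos (Nat.gcd_one_left _)
  simpa [one_div] using h1

/-- The value currency `ℤ/N → ℚ/ℤ`, `t ↦ t.val • N⁻¹`, is injective. [cite: Kato2004Asterisque, §17.13 (p. 279)] -/
theorem zmod_eq_of_val_smul_eq {t t' : ZMod N}
    (h : t.val • ((((N : ℚ))⁻¹ : ℚ) : AddCircle (1 : ℚ)) = t'.val • ((((N : ℚ))⁻¹ : ℚ) : AddCircle (1 : ℚ))) : t = t' := by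
  -- `t ↦ t.val • u` is the additive map `e = ZMod.lift` of `z ↦ z • u`; its kernel is trivial since `addOrderOf u = N`
  set u : AddCircle (1 : ℚ) := ((((N : ℚ))⁻¹ : ℚ) : AddCircle (1 : ℚ)) with hu
  have hord : addOrderOf u = N := addOrderOf_inv_natCast
  have hN0 : N • u = 0 := by rw [← hord]; exact addOrderOf_nsmul_eq_zero u
  let e : ZMod N →+ AddCircle (1 : ℚ) :=
    ZMod.lift N ⟨zmultiplesHom (AddCircle (1 : ℚ)) u, by
      change (N : ℤ) • u = 0
      rw [natCast_zsmul, hN0]⟩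
  have he : ∀ s : ZMod N, e s = s.val • u := by
    intro s
    conv_lhs => rw [← ZMod.natCast_zmod_val s]
    rw [show ((s.val : ℕ) : ZMod N) = ((s.val : ℤ) : ZMod N) by push_cast; rfl, ZMod.lift_coe]
    change (s.val : ℤ) • u = s.val • u
    rw [natCast_zsmul]
  have key : ∀ s : ZMod N, e s = 0 → s = 0 := by
    intro s hs
    rw [he] at hs
    have hdvd : addOrderOf u ∣ s.val := addOrderOf_dvd_of_nsmul_eq_zero hs
    rw [hord] at hdvd
    exact (ZMod.val_eq_zero s).mp (Nat.eq_zero_of_dvd_of_lt hdvd (ZMod.val_lt s))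
  have h0 : e (t - t') = 0 := by rw [map_sub, he, he, h, sub_self]
  exact sub_eq_zero.mp (key _ h0)

/-- **An additive `ψ : D →+ ℚ/ℤ` on an `N`-torsion group is `y ↦ (f y).val • N⁻¹` for an additive `f : D →+ ℤ/N`** (the values of `ψ` are
`N`-torsion, hence multiples of the order-`N` element `N⁻¹`; `t ↦ t.val • N⁻¹` is an injective additive map `ℤ/N → ℚ/ℤ`, so `ψ` factors
through it additively). [cite: Kato2004Asterisque, §17.13 (p. 279)] [cite: MilneADT2006, Ch. I §0] -/
theorem exists_zmodHom_of_nsmul_eq_zero (hD : ∀ y : D, N • y = 0) (ψ : D →+ AddCircle (1 : ℚ)) :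
    ∃ f : D →+ ZMod N, ∀ y, ψ y = (f y).val • ((((N : ℚ))⁻¹ : ℚ) : AddCircle (1 : ℚ)) := by
  set u : AddCircle (1 : ℚ) := ((((N : ℚ))⁻¹ : ℚ) : AddCircle (1 : ℚ)) with hu
  have hpos : 0 < N := Nat.pos_of_ne_zero (NeZero.ne N)
  have hord : addOrderOf u = N := addOrderOf_inv_natCast
  have hN0 : N • u = 0 := by rw [← hord]; exact addOrderOf_nsmul_eq_zero u
  -- the additive map `e : ℤ/N → ℚ/ℤ`, `e t = t.val • u`
  let e : ZMod N →+ AddCircle (1 : ℚ) :=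
    ZMod.lift N ⟨zmultiplesHom (AddCircle (1 : ℚ)) u, by
      change (N : ℤ) • u = 0
      rw [natCast_zsmul, hN0]⟩
  have he : ∀ t : ZMod N, e t = t.val • u := by
    intro t
    conv_lhs => rw [← ZMod.natCast_zmod_val t]
    rw [show ((t.val : ℕ) : ZMod N) = ((t.val : ℤ) : ZMod N) by push_cast; rfl, ZMod.lift_coe]
    change (t.val : ℤ) • u = t.val • u
    rw [natCast_zsmul]
  have heinj : Function.Injective e := by
    intro t t' h
    rw [he, he] at h
    exact zmod_eq_of_val_smul_eq h
  -- every value of `ψ` is in the range of `e`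
  have hrange : ∀ y, ψ y ∈ e.range := by
    intro y
    have hy : N • ψ y = 0 := by rw [← map_nsmul, hD y, map_zero]
    obtain ⟨z, hz⟩ := AddSubgroup.mem_zmultiples_iff.mp (addCircle_mem_zmultiples_of_addOrderOf_eq N hpos u (ψ y) hord hy)
    refine ⟨(z : ZMod N), ?_⟩
    rw [ZMod.lift_coe]
    exact hz
  refine ⟨(AddMonoidHom.ofInjective heinj).symm.toAddMonoidHom.comp (ψ.codRestrict e.range hrange), fun y => ?_⟩
  rw [← he]
  change ψ y = e ((AddMonoidHom.ofInjective heinj).symm (ψ.codRestrict e.range hrange y))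
  rw [AddMonoidHom.apply_ofInjective_symm heinj]
  rfl

/-- Uniqueness in `exists_zmodHom_of_nsmul_eq_zero`: the factoring functional is determined by `ψ`. [cite: Kato2004Asterisque, §17.13 (p. 279)] -/
theorem zmodHom_unique {ψ : D → AddCircle (1 : ℚ)} {f f' : D →+ ZMod N}
    (hf : ∀ y, ψ y = (f y).val • ((((N : ℚ))⁻¹ : ℚ) : AddCircle (1 : ℚ)))
    (hf' : ∀ y, ψ y = (f' y).val • ((((N : ℚ))⁻¹ : ℚ) : AddCircle (1 : ℚ))) : f = f' :=
  AddMonoidHom.ext fun y => zmod_eq_of_val_smul_eq ((hf y).symm.trans (hf' y))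

end Algebra

/-! ## §2 Generic coefficients: a `ℚ/ℤ`-character of `H¹(U_n, M|)` IS a layer class under the layer pairing -/

section Layer

variable {M : Type} [AddCommGroup M] [TopologicalSpace M] [DiscreteTopology M] [Finite M]
  (ρM : DiscreteGaloisModule ℚ M) (N : ℕ) [NeZero N]
  (e : M → M → AlgebraicClosure ℚ)
  (hμ : ∀ S T, e S T ^ N = 1)
  (hadd₁ : ∀ S₁ S₂ T, e (S₁ + S₂) T = e S₁ T * e S₂ T)
  (hadd₂ : ∀ S T₁ T₂, e S (T₁ + T₂) = e S T₁ * e S T₂)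
  (hgal : ∀ (σ : absoluteGaloisGroup ℚ) (S T : M), σ • e S T = e (ρM σ S) (ρM σ T))
  {p : ℕ} [Fact p.Prime] (κ : ZpExtension ℚ p) (v : HeightOneSpectrum (𝓞 ℚ)) (n : ℕ)

/-- **Every additive `ψ : H¹(U_n, M|) →+ ℚ/ℤ` is `y ↦ (⟨b, y⟩_{n,N,v}).val • N⁻¹` for a UNIQUE layer class `b ∈ H¹(U_n, M|)`** (`N • M = 0`,
`e` non-degenerate): §1 turns `ψ` into a functional `H¹(U_n, M|) →+ ℤ/N`, which is `⟨b, ·⟩` for a unique `b` by local Tate duality at the layer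
(N4 `layerPairingH1Of_bijective`). [cite: MilneADT2006, Ch. I Cor. 2.3] [cite: Kobayashi2003, (8.23) (p. 18)] -/
theorem existsUnique_layerClass_of_addCircleHom [CompactSpace (absoluteGaloisGroup ℚ)]
    [CompactSpace (absoluteGaloisGroup (v.adicCompletion ℚ))] [Fintype (absoluteGaloisGroup ℚ ⧸ κ.layerSubgroup n)]
    (hnondeg : ∀ T, (∀ S, e S T = 1) → T = 0) (hN : ∀ m : M, N • m = 0)
    (ψ : continuousCohomology 1 (subgroupRep (localRepOf ρM v) (layerGroup κ v n)) →+ AddCircle (1 : ℚ)) :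
    ∃! b : continuousCohomology 1 (subgroupRep (localRepOf ρM v) (layerGroup κ v n)),
      ∀ y, ψ y = (layerPairingH1Of ρM N e hμ hadd₁ hadd₂ hgal κ v n b y).val • ((((N : ℚ))⁻¹ : ℚ) : AddCircle (1 : ℚ)) := by
  obtain ⟨f, hf⟩ := exists_zmodHom_of_nsmul_eq_zero (nsmul_layerH1_eq_zero ρM N κ v n hN) ψ
  have hbij := (layerPairingH1Of_bijective ρM N e hμ hadd₁ hadd₂ hgal κ v n hnondeg hN).1
  obtain ⟨b, hb⟩ := hbij.2 f
  refine ⟨b, fun y => by rw [hf y, hb], fun b' hb' => hbij.1 ?_⟩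
  rw [hb]
  exact zmodHom_unique hb' hf

end Layer

/-! ## §3 The `ρ`-instantiation through `j_{m,k}` in the currency of `AwayPins.hlocdS` -/

section Rho

variable (S : Set (PadicAlgCl 2)) (ρ : FramedGaloisRep ℚ ↥(padicCoeffIntegers S) 2)
  (ePk : ∀ k : ℕ, ↥(AddSubgroup.torsionBy (Cofree ρ ↥(padicCoeffField S)) ((2 ^ k : ℕ) : ℤ)) →
    ↥(AddSubgroup.torsionBy (Cofree ρ ↥(padicCoeffField S)) ((2 ^ k : ℕ) : ℤ)) → AlgebraicClosure ℚ)
  (hμPk : ∀ k a b, ePk k a b ^ (2 ^ k) = 1)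
  (hadd₁Pk : ∀ k a₁ a₂ b, ePk k (a₁ + a₂) b = ePk k a₁ b * ePk k a₂ b)
  (hadd₂Pk : ∀ k a b₁ b₂, ePk k a (b₁ + b₂) = ePk k a b₁ * ePk k a b₂)
  (hgalPk : ∀ k (σ : absoluteGaloisGroup ℚ) (a b : ↥(AddSubgroup.torsionBy (Cofree ρ ↥(padicCoeffField S)) ((2 ^ k : ℕ) : ℤ))),
    σ • ePk k a b = ePk k (cofreeTorsionGaloisModule S ρ _ σ a) (cofreeTorsionGaloisModule S ρ _ σ b))
  (hnondeg : ∀ k T, (∀ a, ePk k a T = 1) → T = 0)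
  (κ : ZpExtension ℚ 2) (w : HeightOneSpectrum (𝓞 ℚ))

/-- The two spellings of `2^{-k} ∈ ℚ/ℤ` agree: `((2^k : ℕ) : ℚ)⁻¹ = ((2 : ℚ)^k)⁻¹`. [cite: Kato2004Asterisque, §17.13 (p. 279)] -/
theorem inv_natCast_two_pow (k : ℕ) :
    (((((2 ^ k : ℕ) : ℚ))⁻¹ : ℚ) : AddCircle (1 : ℚ)) = ((((2 : ℚ) ^ k)⁻¹ : ℚ) : AddCircle (1 : ℚ)) := by
  push_cast
  rfl

include hnondeg in
/-- **A character of `D_w` read on `H¹(U_{m,w}, A_ρ[2^k]|)` through `j_{m,k}` IS a layer class**: for `χ : CharacterModule (Dloc S κ ρ w)` there is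
a UNIQUE `b ∈ Dlev S κ ρ w m k` with `χ (jAway w m k y) = (⟨b, y⟩_{m,2^k,w}).val • 2^{-k}` for all `y` — exactly the value currency of the pin
`AwayPins.hlocdS` (there `b = loc_m(red_{2^k}(conj_{σ_c} proj_m x))`, global; here any local `b`). [cite: MilneADT2006, Ch. I Cor. 2.3]
[cite: PerrinRiou1994Invent, §3.6.1] [cite: Kobayashi2003, (8.23) (p. 18)] -/
theorem existsUnique_dlev_of_character [CompactSpace (absoluteGaloisGroup ℚ)] [CompactSpace (absoluteGaloisGroup (w.adicCompletion ℚ))]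
    (m k : ℕ) [Fintype (absoluteGaloisGroup ℚ ⧸ κ.layerSubgroup m)]
    [Finite ↥(AddSubgroup.torsionBy (Cofree ρ ↥(padicCoeffField S)) ((2 ^ k : ℕ) : ℤ))]
    (χ : CharacterModule (Dloc S κ ρ w)) :
    ∃! b : Dlev S κ ρ w m k, ∀ y : Dlev S κ ρ w m k,
      χ (jAway S κ ρ w m k y) =
        (layerPairingH1Of (cofreeTorsionGaloisModule S ρ ((2 ^ k : ℕ) : ℤ)) (2 ^ k) (ePk k) (hμPk k) (hadd₁Pk k) (hadd₂Pk k)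
            (hgalPk k) κ w m b y).val • ((((2 : ℚ) ^ k)⁻¹ : ℚ) : AddCircle (1 : ℚ)) := by
  haveI : NeZero (2 ^ k) := ⟨pow_ne_zero k two_ne_zero⟩
  have hN : ∀ a : ↥(AddSubgroup.torsionBy (Cofree ρ ↥(padicCoeffField S)) ((2 ^ k : ℕ) : ℤ)), (2 ^ k) • a = 0 :=
    fun a => AddSubgroup.torsionBy.nsmul a
  have h := existsUnique_layerClass_of_addCircleHom (cofreeTorsionGaloisModule S ρ ((2 ^ k : ℕ) : ℤ)) (2 ^ k) (ePk k) (hμPk k)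
    (hadd₁Pk k) (hadd₂Pk k) (hgalPk k) κ w m (hnondeg k) hN (χ.comp (jAway S κ ρ w m k))
  rw [← inv_natCast_two_pow]
  obtain ⟨b, hb, huniq⟩ := h
  exact ⟨b, fun y => hb y, fun b' hb' => huniq b' fun y => hb' y⟩

end Rho

/-! ## §4 The (α)-class of a `Cosets κ w`-indexed family of characters, and its readback in the `hT` currency of p697362 -/

section Alpha

variable (S : Set (PadicAlgCl 2)) (ρ : FramedGaloisRep ℚ ↥(padicCoeffIntegers S) 2)
  (ePk : ∀ k : ℕ, ↥(AddSubgroup.torsionBy (Cofree ρ ↥(padicCoeffField S)) ((2 ^ k : ℕ) : ℤ)) →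
    ↥(AddSubgroup.torsionBy (Cofree ρ ↥(padicCoeffField S)) ((2 ^ k : ℕ) : ℤ)) → AlgebraicClosure ℚ)
  (hμPk : ∀ k a b, ePk k a b ^ (2 ^ k) = 1)
  (hadd₁Pk : ∀ k a₁ a₂ b, ePk k (a₁ + a₂) b = ePk k a₁ b * ePk k a₂ b)
  (hadd₂Pk : ∀ k a b₁ b₂, ePk k a (b₁ + b₂) = ePk k a b₁ * ePk k a b₂)
  (hgalPk : ∀ k (σ : absoluteGaloisGroup ℚ) (a b : ↥(AddSubgroup.torsionBy (Cofree ρ ↥(padicCoeffField S)) ((2 ^ k : ℕ) : ℤ))),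
    σ • ePk k a b = ePk k (cofreeTorsionGaloisModule S ρ _ σ a) (cofreeTorsionGaloisModule S ρ _ σ b))
  (hnondeg : ∀ k T, (∀ a, ePk k a T = 1) → T = 0)
  (κ : ZpExtension ℚ 2) (hκ : κ.IsCyclotomic) (w : HeightOneSpectrum (𝓞 ℚ)) (hw : ((2 : ℕ) : 𝓞 ℚ) ∉ w.asIdeal)

include hnondeg hκ hw in
set_option maxHeartbeats 1600000 in
-- the `ρ`-coefficient coinduced modules make the elaboration of this statement expensive (cf. `…DeepHalfAtTwoLevelwise`)
/-- **The (α)-class from characters, with its Mackey components and its readback.** For the cyclotomic `ℤ₂`-extension, an odd place `w`,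
`n ≥ n_w`, a level `k` and a `Cosets κ w`-indexed family `χ` of characters of `D_w`: there are layer classes `b c ∈ H¹(U_{n,w}, A_ρ[2^k]|)`
representing `χ c ∘ j_{n,k}` (§3) and ONE local class `t ∈ H¹(ℚ_w, Maps(Γ_ℚ ⧸ Γ_n, A_ρ[2^k]))` with `H¹(Φ_{c.out Γ_n}) t = Sh(b c)` for every
coset `c` (Mackey joint surjectivity over the index datum `CosetFrame.bijective_cosets_out`), and for every layer class `a ∈ H¹(Γ_n, A_ρ[2^k])`
and every choice of representatives for the global Shapiro lift,
`⟨t, loc_w(H¹(Ψ)(Sh a))⟩_{w, canonical} = ∑ c, ⟨b c, loc_n(c.out · a)⟩_{n,2^k,w}` — the value the S4₀ assembly p697362 reads (`hT`), expressed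
through the frame's per-coset data. [cite: Brown1982, III §5 (5.6)(b)] [cite: NeukirchSchmidtWingberg2008, I §5 Prop. (1.5.3) (iv), I §6 (1.6.4)–(1.6.5)]
[cite: MilneADT2006, Ch. I §6 (proof of Prop. 6.9)] [cite: Kobayashi2003, (8.23) (p. 18)] -/
theorem exists_local_of_characters [CompactSpace ↥(padicCoeffIntegers S)] [CompactSpace (absoluteGaloisGroup ℚ)]
    [CompactSpace (absoluteGaloisGroup (w.adicCompletion ℚ))]
    {n : ℕ} (hn : nfl w ≤ n) (k : ℕ) [Fintype (absoluteGaloisGroup ℚ ⧸ κ.layerSubgroup n)] [Fintype (Cosets κ w)]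
    [Finite ↥(AddSubgroup.torsionBy (Cofree ρ ↥(padicCoeffField S)) ((2 ^ k : ℕ) : ℤ))]
    (χ : Cosets κ w → CharacterModule (Dloc S κ ρ w)) :
    ∃ (b : Cosets κ w → Dlev S κ ρ w n k)
      (t : galoisCohomology
        (((cofreeTorsionGaloisModule S ρ ((2 ^ k : ℕ) : ℤ)).coind (κ.layerSubgroup n) (κ.isOpen_layerSubgroup n)).toLocal (Sum.inr w)) 1),
      (∀ (c : Cosets κ w) (y : Dlev S κ ρ w n k),
        χ c (jAway S κ ρ w n k y) =
          (layerPairingH1Of (cofreeTorsionGaloisModule S ρ ((2 ^ k : ℕ) : ℤ)) (2 ^ k) (ePk k) (hμPk k) (hadd₁Pk k) (hadd₂Pk k)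
              (hgalPk k) κ w n (b c) y).val • ((((2 : ℚ) ^ k)⁻¹ : ℚ) : AddCircle (1 : ℚ))) ∧
      (∀ c : Cosets κ w,
        cohomologyMap (resCoindFinHomR (cofreeTorsionGaloisModule S ρ ((2 ^ k : ℕ) : ℤ)).toTopRep (κ.layerSubgroup n)
            (resGalOfEmb (closureEmb (K := ℚ) (w.adicCompletion ℚ))) (c.out : absoluteGaloisGroup ℚ ⧸ κ.layerSubgroup n)) 1 t =
          layerShapiroOf (cofreeTorsionGaloisModule S ρ ((2 ^ k : ℕ) : ℤ)) κ w n (b c)) ∧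
      ∀ {s : absoluteGaloisGroup ℚ ⧸ κ.layerSubgroup n → absoluteGaloisGroup ℚ}
        (hs : ∀ x : absoluteGaloisGroup ℚ ⧸ κ.layerSubgroup n, (s x : absoluteGaloisGroup ℚ ⧸ κ.layerSubgroup n) = x)
        (hs1 : s ((1 : absoluteGaloisGroup ℚ) : absoluteGaloisGroup ℚ ⧸ κ.layerSubgroup n) = 1)
        (a : H1 (cofreeTorsionGaloisModule S ρ ((2 ^ k : ℕ) : ℤ)) (κ.layerSubgroup n)),
        localTatePairingZMod
            ((cofreeTorsionGaloisModule S ρ ((2 ^ k : ℕ) : ℤ)).coind (κ.layerSubgroup n) (κ.isOpen_layerSubgroup n)) (2 ^ k) (Sum.inr w)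
            (LocalInvariants.canonical ℚ (2 ^ k) (Sum.inr w)) t
            (galoisCohomology.localization
              (((cofreeTorsionGaloisModule S ρ ((2 ^ k : ℕ) : ℤ)).coind (κ.layerSubgroup n) (κ.isOpen_layerSubgroup n)).tateDual (2 ^ k))
              (Sum.inr w) 1
              (cohomologyMap (coindTateDualMor (cofreeTorsionGaloisModule S ρ ((2 ^ k : ℕ) : ℤ))
                  (cofreeTorsionGaloisModule S ρ ((2 ^ k : ℕ) : ℤ)) (κ.layerSubgroup n)
                  (pairingHomOfFun (2 ^ k) (ePk k) (hμPk k) (hadd₁Pk k) (hadd₂Pk k)) (κ.isOpen_layerSubgroup n)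
                  (fun σ a b => (contPairingOfFun (cofreeTorsionGaloisModule S ρ ((2 ^ k : ℕ) : ℤ)) (2 ^ k) (ePk k) (hμPk k) (hadd₁Pk k)
                    (hadd₂Pk k) (hgalPk k)).toLin_smul σ a b)) 1
                (shapiroLift (cofreeTorsionGaloisModule S ρ ((2 ^ k : ℕ) : ℤ)).toTopRep (κ.layerSubgroup n) (κ.isOpen_layerSubgroup n)
                  hs hs1 a))) =
          ∑ c : Cosets κ w, layerPairingH1Of (cofreeTorsionGaloisModule S ρ ((2 ^ k : ℕ) : ℤ)) (2 ^ k) (ePk k) (hμPk k) (hadd₁Pk k)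
            (hadd₂Pk k) (hgalPk k) κ w n (b c)
            (layerLocOf (cofreeTorsionGaloisModule S ρ ((2 ^ k : ℕ) : ℤ)) κ w n
              (conjMap (cofreeTorsionGaloisModule S ρ ((2 ^ k : ℕ) : ℤ)).toTopRep (κ.layerSubgroup n) c.out 1 a)) := by
  haveI : NeZero (2 ^ k) := ⟨pow_ne_zero k two_ne_zero⟩
  -- the layer classes `b c` (§3)
  have hb := fun c : Cosets κ w =>
    (existsUnique_dlev_of_character S ρ ePk hμPk hadd₁Pk hadd₂Pk hgalPk hnondeg κ w n k (χ c)).exists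
  choose b hb using hb
  -- the Mackey index datum and the local class with components `Sh(b c)`
  have hbij := CosetFrame.bijective_cosets_out κ hκ w hw hn
  obtain ⟨u, hu⟩ := exists_local_forall_component_eq (cofreeTorsionGaloisModule S ρ ((2 ^ k : ℕ) : ℤ)) κ w n
    (fun c : Cosets κ w => (c.out : absoluteGaloisGroup ℚ)) hbij b
  refine ⟨b, u, hb, hu, fun hs hs1 a => ?_⟩
  rw [localization_cohomologyMap_coindTateDualMor]
  exact localTatePairingZMod_canonical_coind_eq_sum_layerPairingH1Of (cofreeTorsionGaloisModule S ρ ((2 ^ k : ℕ) : ℤ)) (2 ^ k)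
    (ePk k) (hμPk k) (hadd₁Pk k) (hadd₂Pk k) (hgalPk k) κ w n (fun c : Cosets κ w => (c.out : absoluteGaloisGroup ℚ)) hbij u _ b
    (fun c => layerLocOf (cofreeTorsionGaloisModule S ρ ((2 ^ k : ℕ) : ℤ)) κ w n
      (conjMap (cofreeTorsionGaloisModule S ρ ((2 ^ k : ℕ) : ℤ)).toTopRep (κ.layerSubgroup n) c.out 1 a))
    hu (fun c => cohomologyMap_resCoindFinHomR_localization_shapiroLift (cofreeTorsionGaloisModule S ρ ((2 ^ k : ℕ) : ℤ)) κ w n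
      hs hs1 c.out a)

end Alpha

end ThetaTransport.AwayCharacterReadback

end Summit.BirchSwinnertonDyer.BirchSwinnertonDyer.Theorems

end
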